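import Summits.CriticalPhenomena.CardyFormulaZ2.Theses.CardyOrderDuality
import Summits.CriticalPhenomena.CardyFormulaZ2.Theorems.CardyWhiteToColouredSimilarityUpgradeStubDualSum

/-!
# `CardyOrderDuality.DualSum` (stmt-CriticalPhenomena-4716) holds

Route `CardyOrderDuality`, sub-problem `CardyFormulaZ2`, crux `DualSum` (rank 4): for every conformal
rectangle `R = (Ω; a, b, c, d)` — any Jordan domain with four marked boundary points, no regularity of
`∂Ω` — the `P_{1/2}`-probabilities of an open bond-`ℤ²` crossing `(ab)_δ ↔ (cd)_δ` and of an open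
crossing `(bc)_δ ↔ (da)_δ` of the SAME discrete domain `Ω_δ` (G02 discretisation: largest mesh
component, distance-rule discrete arcs) sum to `1 + o(1)` as `δ → 0⁺`.

This is the tree theorem `Summit.CriticalPhenomena.CardyFormulaZ2.Cruxes.SimilarityUpgrade.Stubs.stub_dualSum`
(file `CardyWhiteToColouredSimilarityUpgradeStubDualSum.lean`, landed by the lead of crux
`SimilarityUpgrade`, stmt-4597, as groundwork "limit duality for all `R`"): an assembly of the exact
self-duality of the one-quad marginals of every Schramm–Smirnov subsequential limit
(`z2Limits_selfDualMarginals`), the identification of G02's crossing probability with the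
Schramm–Smirnov quad-crossing probability of the quad of `R`
(`JointLimit.eventually_abs_bond_sub_quadCrossingProb_le`), Schramm–Smirnov's Lemma 5.1
(`SchrammSmirnov2011_lemma_5_1_holds`, null frontiers ⇒ portmanteau) and compactness of the laws on
`ℋ_ℂ`.  The "why it might fail" of the item (half-plane 3-arm control at wild boundaries) is not
needed: the Schramm–Smirnov crossing events carry no endpoint slack, so duality is exact at the level
of `ℋ_ℂ` and the boundary effects are absorbed by Lemma 5.1, which the tree proves for every quad.

References: O. Schramm, S. Smirnov, Ann. Probab. 39 (2011) §1.3, Lemma 5.1, Cor. 5.2; G. Grimmett,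
*Percolation* (1999) §11.2, Lemma 11.21; B. Bollobás, O. Riordan, *Percolation* (2006) Ch. 3 Lemma 1.
-/

namespace Summit.CriticalPhenomena.CardyFormulaZ2.Theorems

/-- **`DualSum` holds** (stmt-CriticalPhenomena-4716): for every conformal rectangle `R`,
`bondDomainCrossingProb R δ + discreteCrossingProb half R.carrier δ (R.arc 1) (R.arc 3) → 1` as
`δ → 0⁺`. [cite: SchrammSmirnov2011, Lemma 5.1 and Cor. 5.2] -/
theorem dualSum_proof : Summit.CriticalPhenomena.CardyFormulaZ2.Theses.CardyOrderDuality.DualSum :=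
  Summit.CriticalPhenomena.CardyFormulaZ2.Cruxes.SimilarityUpgrade.Stubs.stub_dualSum

end Summit.CriticalPhenomena.CardyFormulaZ2.Theorems
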